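import Mathlib
import HarnessLib
import Summits.HubbardSuperconductivity.HubbardSuperconductivity.Theorems.KLProgrammeKLRegimeEngineScaleZeroE1Defs

/-!
# v4 `Q`-part of the engine package: `CE := max (2^{60}·Psq²·Rsq²) (klE1CE P)` — the (E1-v4)₀ size by NAME (plan2's «Q4-BY-NAME OK»,
# cell gate-hubbard-kl STATUS 2026-08-27T00:52:56Z; seat hubbard-kl-k3c2-p1, the engine row's (E1)₀ prover)

Why.  The scale-`0` kernel-norm clause `KernelNormsV4 … 0` of `stub_engine_scale0` is proved on every admissible frame by
`kernelNormsV4_zero_of_klEng_of_le_CE` (`…ScaleZeroE1Defs`) under the ONE package condition `klE1CE P ≤ Q.CE`; `klE1CE P` contains the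
existential absolute constant `sectorCircLineConst` (ContDiffBump sector profile) and is numerically `≈ 2^{180}`, so no numeral `Q`-package
(v3: `2^{60}·Psq²·Rsq²`) can dominate it.  `Q` is the ENGINE's own `∃`-witness in `EngineP4` (chosen after `G, P, R`, before `c₃, U₀`),
hence the repair is a package NUMBER: **`klEngQ4 P R`** = `klEngQ3 P R` with `CE := max (2^{60}·klEngPsq P²·klEngRsq R²) (klE1CE P)`
(every other field unchanged; thresholds `klEngC₃3`, `klEngU₀3`, `klEngL₃`, `klEngM₃` and the `G`-part UNCHANGED).  Lemmas: `klEngQ4_wf`,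
the v3-dominance `klEngQ3_CE_le_klEngQ4_CE` / `klE1CE_le_klEngQ4_CE` / field equalities, `deltaUV_absorbed4`, and the (E1)₀ conjunct of
`stub_engine_scale0` at this package: **`kernelNormsV4_zero_klEngQ4`** under exactly the stub's binders.
-/

noncomputable section

namespace Summit.HubbardSuperconductivity.HubbardSuperconductivity.Theorems.EngineV8

set_option linter.dupNamespace false -- summit = problem name (single-conjunct summit), D-0017

open Real Finset Literature.MathematicalPhysics.QuantumLattice Literature.Probability.LatticeModels
open Summit.HubbardSuperconductivity.HubbardSuperconductivity.Theorems.KLRegimeSplit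
open Summit.HubbardSuperconductivity.HubbardSuperconductivity.Theorems.KLProgrammeLegKernels

/-- **`klEngQ4 P R` — the engine's constants `Q`, v4**: as `klEngQ3 P R` except `CE := max (2^{60}·klEngPsq²·klEngRsq²) (klE1CE P)`. -/
def klEngQ4 (P : SplitConsts) (R : RenConsts) : EngConsts where
  CE := max (2 ^ 60 * klEngPsq P ^ 2 * klEngRsq R ^ 2) (klE1CE P)
  CR := 2 ^ 60 * klEngPsq P ^ 2 * klEngRsq R ^ 2
  c0 := 2 ^ 60 * klEngPsq P ^ 2 * klEngRsq R ^ 2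
  cE4 := 2 ^ 60 * klEngPsq P ^ 2 * klEngRsq R ^ 2
  S' := fun _ => 2 ^ 60 * klEngPsq P ^ 2 * klEngRsq R ^ 2
  Bf := 2 ^ 60 * klEngPsq P ^ 2 * klEngRsq R ^ 2
  SL := 2 ^ 60 * klEngPsq P ^ 2 * klEngRsq R ^ 2
  CL := fun β n => 2 ^ 60 * klEngPsq P ^ 2 * klEngRsq R ^ 2 * (β ^ 2 + 1) * (4 : ℝ) ^ n
  L0 := fun β => 2 ^ 10 * (⌈|β|⌉₊ + 1) ^ 2
  M0 := fun β L => 2 ^ 10 * (⌈|β|⌉₊ + 1) ^ 2 * (L + 1) ^ 2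

/-- `klEngQ4 P R` is well formed (unconditionally). -/
theorem klEngQ4_wf (P : SplitConsts) (R : RenConsts) : (klEngQ4 P R).WF := by
  have h2 : (0 : ℝ) ≤ 2 ^ 60 := pow_nonneg zero_le_two 60
  have hc : (0 : ℝ) ≤ 2 ^ 60 * klEngPsq P ^ 2 * klEngRsq R ^ 2 :=
    mul_nonneg (mul_nonneg h2 (sq_nonneg _)) (sq_nonneg _)
  have hCE : (0 : ℝ) ≤ max (2 ^ 60 * klEngPsq P ^ 2 * klEngRsq R ^ 2) (klE1CE P) := le_max_of_le_left hc
  refine ⟨hCE, hc, hc, hc, fun _ => hc, hc, hc, fun β n => ?_⟩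
  show (0 : ℝ) ≤ 2 ^ 60 * klEngPsq P ^ 2 * klEngRsq R ^ 2 * (β ^ 2 + 1) * (4 : ℝ) ^ n
  exact mul_nonneg (mul_nonneg hc (by nlinarith [sq_nonneg β])) (pow_nonneg (by norm_num) n)

/-! ## v3-dominance: everything proved at v3 transfers -/

/-- `(klEngQ3 P R).CE ≤ (klEngQ4 P R).CE`. -/
theorem klEngQ3_CE_le_klEngQ4_CE (P : SplitConsts) (R : RenConsts) : (klEngQ3 P R).CE ≤ (klEngQ4 P R).CE :=
  le_max_left _ _

/-- **`klE1CE P ≤ (klEngQ4 P R).CE`** — the (E1-v4)₀ package condition holds at v4. -/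
theorem klE1CE_le_klEngQ4_CE (P : SplitConsts) (R : RenConsts) : klE1CE P ≤ (klEngQ4 P R).CE :=
  le_max_right _ _

/-- The other fields are those of v3. -/
theorem klEngQ4_CR (P : SplitConsts) (R : RenConsts) : (klEngQ4 P R).CR = (klEngQ3 P R).CR := rfl

/-- `c0` is that of v3. -/
theorem klEngQ4_c0 (P : SplitConsts) (R : RenConsts) : (klEngQ4 P R).c0 = (klEngQ3 P R).c0 := rfl

/-- `cE4` is that of v3. -/
theorem klEngQ4_cE4 (P : SplitConsts) (R : RenConsts) : (klEngQ4 P R).cE4 = (klEngQ3 P R).cE4 := rfl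

/-- `S'` is that of v3. -/
theorem klEngQ4_S' (P : SplitConsts) (R : RenConsts) : (klEngQ4 P R).S' = (klEngQ3 P R).S' := rfl

/-- `Bf` is that of v3. -/
theorem klEngQ4_Bf (P : SplitConsts) (R : RenConsts) : (klEngQ4 P R).Bf = (klEngQ3 P R).Bf := rfl

/-- `SL` is that of v3. -/
theorem klEngQ4_SL (P : SplitConsts) (R : RenConsts) : (klEngQ4 P R).SL = (klEngQ3 P R).SL := rfl

/-- `CL` is that of v3. -/
theorem klEngQ4_CL (P : SplitConsts) (R : RenConsts) : (klEngQ4 P R).CL = (klEngQ3 P R).CL := rfl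

/-- `L0` is that of v3. -/
theorem klEngQ4_L0 (P : SplitConsts) (R : RenConsts) : (klEngQ4 P R).L0 = (klEngQ3 P R).L0 := rfl

/-- `M0` is that of v3. -/
theorem klEngQ4_M0 (P : SplitConsts) (R : RenConsts) : (klEngQ4 P R).M0 = (klEngQ3 P R).M0 := rfl

/-- The Δ-UV absorption inequality at the v4 package: `32·Gfr 0 + 4·cr ≤ (klEngQ4 P R).CR`. -/
theorem deltaUV_absorbed4 (P : SplitConsts) (R : RenConsts) : 32 * R.Gfr 0 + 4 * R.cr ≤ (klEngQ4 P R).CR := by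
  rw [klEngQ4_CR]; exact deltaUV_absorbed3 P R

/-! ## The (E1-v4)₀ conjunct of `stub_engine_scale0` at the v4 package -/

/-- **(E1-v4)₀ at `klEngQ4`, under exactly the binders of `stub_engine_scale0`**: `P.WF`, `R.WF2`, `0 < c ≤ klEngC₃3 P R`, `μ ∈ klWindowC`,
`0 < U ≤ klEngU₀3 P R c`, `klBetaMin ≤ β ≤ e^{c/U²}`, `FrameOK R U (nScales β) μ K`, `klEngL₃ β U ≤ L`, `klEngM₃ β U L ≤ M` ⟹
`KernelNormsV4 L M P (klEngQ4 P R) β U μ K 0`. -/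
theorem kernelNormsV4_zero_klEngQ4 (P : SplitConsts) (R : RenConsts) (c : ℝ) (hP : P.WF) (hR : R.WF2) (hc : 0 < c)
    (hc₃ : c ≤ klEngC₃3 P R) (μ : ℝ) (hμ : μ ∈ klWindowC) (U : ℝ) (hU : 0 < U) (hU₀ : U ≤ klEngU₀3 P R c) (β : ℝ)
    (hβ : klBetaMin ≤ β) (hβc : β ≤ Real.exp (c / U ^ 2)) (K : TrigPolyC4v) (hK : FrameOK R U (nScales β) μ K) (L M : ℕ)
    [NeZero L] [NeZero M] (hL : klEngL₃ β U ≤ L) (hM : klEngM₃ β U L ≤ M) :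
    KernelNormsV4 L M P (klEngQ4 P R) β U μ K 0 := by
  have _ := hc; have _ := hc₃; have _ := hβc
  have hKlam : 0 < P.Klam := lt_of_lt_of_le one_pos hP.1
  -- `U ≤ klEngU₀3 ≤ 1`
  have hU1 : U ≤ 1 := by
    refine hU₀.trans ?_
    rw [klEngU₀3]
    have hp := one_le_klEngPsq P
    have hr := one_le_klEngRsq R
    have hden : (1 : ℝ) ≤ (2 : ℝ) ^ 120 * klEngPsq P ^ 2 * klEngRsq R ^ 4 * (c ^ 2 + 1) := by
      have h1 : (1 : ℝ) ≤ (2 : ℝ) ^ 120 := by norm_num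
      have h2 : (1 : ℝ) ≤ klEngPsq P ^ 2 := one_le_pow₀ hp
      have h3 : (1 : ℝ) ≤ klEngRsq R ^ 4 := one_le_pow₀ hr
      have h4 : (1 : ℝ) ≤ c ^ 2 + 1 := by nlinarith [sq_nonneg c]
      calc (1 : ℝ) = 1 * 1 * 1 * 1 := by ring
        _ ≤ _ := by gcongr
    exact (div_le_one (by positivity)).2 hden
  exact kernelNormsV4_zero_of_klEng_of_le_CE hR.wf hKlam hU hU1 hU₀ hK hμ hβ hL hM (klE1CE_le_klEngQ4_CE P R)

end Summit.HubbardSuperconductivity.HubbardSuperconductivity.Theorems.EngineV8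

end
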